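import Mathlib.NumberTheory.BernoulliPolynomials
import HarnessLib

/-!
# The distribution relation (Raabe's multiplication formula) of the Bernoulli polynomials

Lang, *Cyclotomic Fields I and II* (GTM 121), Ch. 2 §2, formula **B 3**:
`B_k(X) = N^{k-1} ∑_{a=0}^{N-1} B_k((X + a)/N)`, equivalently (**B 4**)
`N^{k-1} ∑_{t mod N} B_k(y + t/N) = B_k(N y)`: the functions `x ↦ M^{k-1} B_k(⟨x/M⟩)` form a
distribution on the projective system `{ℤ/Mℤ}` (the Bernoulli distribution `E_k`).  Lang's proof
(p. 34) compares the generating series `∑_a t e^{(X+a)t}/(e^{Nt} − 1)` with the definition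
`t e^{tX}/(e^t − 1) = ∑ B_k(X) t^k/k!` (**B 2**) after summing the geometric series `∑ e^{at}`;
this file carries out exactly that computation with Mathlib's `Polynomial.bernoulli` and its
generating function `Polynomial.bernoulli_generating_function`
(`(∑ B_n(t) X^n/n!)(e^X − 1) = X e^{tX}`).

* `bernoulli_eval_mul_eq_pow_mul_sum` — **B 3 / B 4**: `r · B_k(r x) = r^k ∑_{j<r} B_k(x + j/r)`.
* `sum_bernoulli_eval_fiber_eq` — the same as the distribution relation between the levels `r M`
  and `M`: `∑_{j<r} (rM)^{k-1} B_k((b + jM)/(rM)) = M^{k-1} B_k(b/M)` (`k ≥ 1`).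

Everything is proved; there are no named facts.

## References

* S. Lang, *Cyclotomic Fields I and II*, GTM 121, Springer 1990, Ch. 2 §2, **B 2**–**B 4**
  (PDF pp. 33–34). [LangCyclotomic1990]
-/

noncomputable section

open PowerSeries Finset Nat

namespace Literature.NumberTheory.EllipticCurves

/-- The rescaled series `e^{rX} − 1` is non-zero for `r ≠ 0` (its coefficient of `X` is `r`).
[folklore] -/
private theorem rescale_exp_sub_one_ne_zero {r : ℚ} (hr : r ≠ 0) :
    rescale r (exp ℚ - 1) ≠ 0 := by
  intro h
  have h1 := congrArg (coeff 1) h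
  rw [map_sub, map_one, map_sub, coeff_rescale, coeff_exp, coeff_one, if_neg one_ne_zero,
    map_zero, sub_zero, pow_one, factorial_one, cast_one, div_one, map_one, mul_one] at h1
  exact hr h1

/-- **Lang Ch. 2 §2, B 3 / B 4 (distribution relation of the Bernoulli polynomials; Raabe's
multiplication formula)**: for `r ≥ 1`, every `k` and every `x ∈ ℚ`,
`r · B_k(r x) = r^k ∑_{j=0}^{r-1} B_k(x + j/r)`.  Proof as in Lang: with
`F_t(X) = ∑ B_n(t) X^n/n!` one has `F_t(X)(e^X − 1) = X e^{tX}`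
(`Polynomial.bernoulli_generating_function`); hence
`(∑_j F_{x+j/r}(rX)) (e^{rX} − 1) = rX e^{rxX} ∑_j e^{jX} = r F_{rx}(X)(e^X − 1)(1 + e^X + ⋯ + e^{(r-1)X})`,
and `e^{rX} − 1 ≠ 0` may be cancelled in the domain `ℚ⟦X⟧`; comparing the coefficients of `X^k`
gives the formula. [cite: LangCyclotomic1990, Ch. 2 §2, B 3–B 4 (PDF pp. 33–34)] -/
theorem bernoulli_eval_mul_eq_pow_mul_sum (k : ℕ) {r : ℕ} (hr : 0 < r) (x : ℚ) :
    (r : ℚ) * (Polynomial.bernoulli k).eval ((r : ℚ) * x) =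
      (r : ℚ) ^ k * ∑ j ∈ range r, (Polynomial.bernoulli k).eval (x + (j : ℚ) / r) := by
  have hr0 : (r : ℚ) ≠ 0 := by exact_mod_cast hr.ne'
  -- the generating series of the Bernoulli polynomials
  set F : ℚ → ℚ⟦X⟧ := fun t ↦ PowerSeries.mk fun n ↦ Polynomial.aeval t ((1 / n ! : ℚ) • Polynomial.bernoulli n)
    with hF
  have hgen : ∀ t : ℚ, F t * (exp ℚ - 1) = X * rescale t (exp ℚ) := fun t ↦
    Polynomial.bernoulli_generating_function t
  -- the key identity, multiplied by `e^{rX} - 1`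
  have key : (∑ j ∈ range r, rescale (r : ℚ) (F (x + (j : ℚ) / r))) * rescale (r : ℚ) (exp ℚ - 1) =
      (C (r : ℚ) * F ((r : ℚ) * x)) * rescale (r : ℚ) (exp ℚ - 1) := by
    have hL : (∑ j ∈ range r, rescale (r : ℚ) (F (x + (j : ℚ) / r))) * rescale (r : ℚ) (exp ℚ - 1) =
        C (r : ℚ) * X * rescale ((r : ℚ) * x) (exp ℚ) * ∑ j ∈ range r, exp ℚ ^ j := by
      rw [sum_mul, mul_sum]
      refine sum_congr rfl fun j _ ↦ ?_
      rw [← map_mul, hgen, map_mul, rescale_X, rescale_rescale,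
        show (x + (j : ℚ) / r) * r = (r : ℚ) * x + (j : ℚ) by field_simp,
        ← exp_mul_exp_eq_exp_add, ← exp_pow_eq_rescale_exp]
      ring
    have hR : (C (r : ℚ) * F ((r : ℚ) * x)) * rescale (r : ℚ) (exp ℚ - 1) =
        C (r : ℚ) * X * rescale ((r : ℚ) * x) (exp ℚ) * ∑ j ∈ range r, exp ℚ ^ j := by
      rw [map_sub, map_one, ← exp_pow_eq_rescale_exp, ← geom_sum_mul, mul_comm (∑ j ∈ range r, _),
        ← mul_assoc, mul_assoc (C (r : ℚ)), hgen, ← mul_assoc]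
    rw [hL, hR]
  have key' := mul_right_cancel₀ (rescale_exp_sub_one_ne_zero hr0) key
  -- compare the coefficients of `X^k`
  have hk := congrArg (coeff k) key'
  simp only [map_sum, coeff_rescale, hF, coeff_mk, coeff_C_mul, map_smul, Polynomial.coe_aeval_eq_eval,
    smul_eq_mul] at hk
  have hfac : (k ! : ℚ) ≠ 0 := by exact_mod_cast (factorial_ne_zero k)
  have hk' := congrArg (fun z : ℚ ↦ (k ! : ℚ) * z) hk
  simp only [mul_sum] at hk'
  rw [mul_sum]
  convert hk'.symm using 1
  · field_simp
  · refine sum_congr rfl fun j _ ↦ ?_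
    field_simp

/-- **The distribution relation between the levels `rM` and `M`** (Lang Ch. 2 §2, the display
after **B 4**: "Multiplying B 4 by `M^{k-1}` yields precisely the distribution relation" for
`x ↦ M^{k-1} B_k(⟨x/M⟩)`): for `k ≥ 1`, `r, M ≥ 1` and every integer `b`,
`∑_{j<r} (rM)^{k-1} B_k((b + jM)/(rM)) = M^{k-1} B_k(b/M)`.
[cite: LangCyclotomic1990, Ch. 2 §2, B 4 and the Bernoulli distribution E_k (PDF p. 34)] -/
theorem sum_bernoulli_eval_fiber_eq {k : ℕ} (hk : 1 ≤ k) {r M : ℕ} (hr : 0 < r) (hM : 0 < M)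
    (b : ℕ) :
    ∑ j ∈ range r, ((r * M : ℕ) : ℚ) ^ (k - 1) *
        (Polynomial.bernoulli k).eval (((b + j * M : ℕ) : ℚ) / ((r * M : ℕ) : ℚ)) =
      (M : ℚ) ^ (k - 1) * (Polynomial.bernoulli k).eval ((b : ℚ) / M) := by
  have hr0 : (r : ℚ) ≠ 0 := by exact_mod_cast hr.ne'
  have hM0 : (M : ℚ) ≠ 0 := by exact_mod_cast hM.ne'
  have h := bernoulli_eval_mul_eq_pow_mul_sum k hr ((b : ℚ) / (r * M))
  have hx : (r : ℚ) * ((b : ℚ) / (r * M)) = (b : ℚ) / M := by field_simp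
  rw [hx] at h
  have hterm : ∀ j ∈ range r, (Polynomial.bernoulli k).eval ((b : ℚ) / (r * M) + (j : ℚ) / r) =
      (Polynomial.bernoulli k).eval (((b + j * M : ℕ) : ℚ) / ((r * M : ℕ) : ℚ)) := by
    intro j _
    congr 1
    push_cast
    field_simp
  rw [sum_congr rfl hterm] at h
  obtain ⟨k, rfl⟩ := Nat.exists_eq_add_of_le hk
  rw [show 1 + k - 1 = k from by omega, ← mul_sum]
  have h' := congrArg (fun z : ℚ ↦ (M : ℚ) ^ k / r * z) h
  convert h'.symm using 1
  · field_simp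
    push_cast
    ring
  · field_simp

end Literature.NumberTheory.EllipticCurves

end
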